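/-
Copyright (c) 2026. All rights reserved.
Released under Apache 2.0 license as described in the file LICENSE.
Authors: abc-iut cell, Cor. 3.12 sub-crew seat abc-iut-c312-5 (gen 8).
-/
import Literature.IUT.LogVolume.UnitLogInnerRadiusDeepTiePowers
import Literature.IUT.LogVolume.UnitLogInnerRadiusTieTorsionFill
import Literature.IUT.LogVolume.UnitLogKernel
import HarnessLib

/-!
# The inner radius at a TIE index `e = A·(p−1)` (`p` odd), VII: the UNIVERSAL lower bound
# `r_in ≥ e/(p−1)` — `ζ_p ∈ K` and `p ∣ A` included — and `r_in ≥ ⌊e/(p−1)⌋` for every `K`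

Proof-only sequel (theorems, no definitions, no named fact) of `UnitLogInnerRadiusDeepTiePowers.lean`.  The inner
radius `r_in` of `Λ = log_p(𝒪_K^×)` (least `r` with `{‖z‖ ≤ ‖ϖ‖ʳ} ⊆ Λ`) is known in the tree in closed form
except in ONE case: `(p−1) ∣ e`, `ζ_p ∈ K`, `p ∣ A := e/(p−1)` (abc-iut-c312-3 parts I–V, abc-iut-rp-d4's
valuation profile: `r_in = ⌊e/(p−1)⌋ + 1` off ties; `= A` for `ζ_p ∉ K`; `= A + 1` for `ζ_p ∈ K ∧ p ∤ A`).  In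
the remaining case `r_in ∈ {A, A+1}` genuinely depends on `K` (on whether `U^{(A·p)} ⊆ μ(K)·(K^×)^p`, i.e. on
the ramification of `K(ζ_{p^{m+1}})/K`).  This file proves the LOWER half with NO hypothesis on `K`:

* §2 **`exists_torsion_mul_pow_of_closedBall_pred_subset`** — transport: if `{‖z‖ ≤ ‖ϖ‖^{A−1}} ⊆ Λ` then every
  `v` with `‖1 − v‖ ≤ ‖ϖ‖^{A·p−1}` is `ζ·u^p` with `ζ` a root of unity and `u` a unit (`x := p⁻¹·log_p v` lies
  in that ball, so `x = log_p u`, and `log_p(v·u^{−p}) = 0` forces torsion by `unitLog_eq_zero_iff`).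
* §3 `exists_ne_eq_mul_pow_of_rootsOfUnity` — pigeonhole: among more than `p` roots of unity of bounded order
  two differ by the `p`-th power of a root of unity (`μ_N` is CYCLIC; exponents modulo `p`).
* §4 `false_of_closedBall_pred_subset_of_family` — the engine: `p + 1` principal units `v_i = 1 + c_i·ϖ^{A·p−1}`
  give two `ζ_i` in one class, whence a unit `W` with `‖1 − W^p‖ = ‖c_i − c_j‖·‖ϖ‖^{A·p−1}`;
  **`not_closedBall_pred_subset_logUnits_of_level`** — `{‖z‖ ≤ ‖ϖ‖^{A−1}} ⊄ log_p(𝒪_K^×)` for EVERY `A` and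
  EVERY `K` (`p` odd): `ζ_p ∉ K` is part V; `ζ_p ∈ K`, `f ≥ 2`: coefficients `0, 1, …, p−1, t` pairwise
  incongruent, forbidden level `A·p − 1` (part VI); `ζ_p ∈ K`, `f = 1`: coefficients `0, 1, …, p−1, ϖ`, forbidden
  levels `A·p − 1` and `A·p` (part VI).  Corollaries **`innerRadius_tie_bracket`** (`{‖z‖ ≤ ‖ϖ‖^{A+1}} ⊆ Λ`,
  `{‖z‖ ≤ ‖ϖ‖^{A−1}} ⊄ Λ`: `A ≤ r_in ≤ A + 1` at every tie), **`innerRadius_tie_of_exists_torsionWitness`**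
  (`r_in = A` EXACTLY given abc-iut-s2-p12's torsion witness), `not_closedBall_div_pred_subset_logUnits_of_dvd`
  (keyed by `(p−1) ∣ e`) and the hypothesis-free **`not_closedBall_div_pred_subset_logUnits`**: for EVERY odd `p`
  and EVERY `K`, `{‖z‖ ≤ ‖ϖ‖^{⌊e/(p−1)⌋ − 1}} ⊄ log_p(𝒪_K^×)`, i.e. `r_in ≥ ⌊e/(p−1)⌋`.

Consumer (record only): the D-0079 R-W window, INHABITED side — the sufficient integer test of the per-summand
(xi-f) cell is antitone in the inner radius, so the certified LOWER bound `R_in ≥ e/(p−1)` at the wild places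
`p ∈ {3, 5}` of the genuine towers (`ζ_p ∈ K_w`, `p ∣ e/(p−1)`) is what the W1 composers consume; the bit
`r_in = A` vs `A + 1` is not needed on that side and is not decided here.

References: [cite: NeukirchANT1999, Ch. II Prop. (5.5)–(5.7)] [cite: Washington1997, Lemma 1.4, §5.1].  Classical
local `p`-adic analysis; `logUnits` is the cell's typing of [IUTchIV] Prop. 1.2's `log_p(R^×)`
([claim: Mochizuki2012, status: disputed] for that locution only).  Nothing here is disputed mathematics; no IUT
statement is asserted; nothing bears on [IUTchIII] Cor. 3.12.
-/

noncomputable section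

open Metric Set
open scoped NormedField

namespace Literature.IUT.LogVolume

namespace LogEnvelope

open RamificationCriterion BoundaryRamification Literature.NumberTheory.GaloisRepresentations.Ultrametric
  Literature.NumberTheory.Transcendental

/-! ### §3 (stated first, no field data). Pigeonhole in the roots of unity -/

/-- **Pigeonhole modulo `p`-th powers in the roots of unity.**  If more than `p` elements `ζ_i ∈ μ_N(M)` of an
integral domain are given, two of them with distinct indices satisfy `ζ_i = ζ_j·η^p` for some `η ∈ μ_N(M)`:
`μ_N(M)` is cyclic, `ζ_i = g^{k_i}`, and two exponents agree modulo `p`. [cite: NeukirchANT1999, Ch. II (5.7)] -/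
theorem exists_ne_eq_mul_pow_of_rootsOfUnity {M : Type*} [CommRing M] [IsDomain M] (q N : ℕ) (hq : q ≠ 0)
    [NeZero N] {ι : Type*} [Fintype ι] (hι : q < Fintype.card ι) (ζ : ι → Mˣ)
    (hζ : ∀ i, ζ i ∈ rootsOfUnity N M) :
    ∃ i j, i ≠ j ∧ ∃ η : Mˣ, η ∈ rootsOfUnity N M ∧ ζ i = ζ j * η ^ q := by
  haveI : NeZero q := ⟨hq⟩
  obtain ⟨g, hg⟩ := IsCyclic.exists_generator (α := rootsOfUnity N M)
  have hk : ∀ i, ∃ k : ℤ, g ^ k = ⟨ζ i, hζ i⟩ := fun i => Subgroup.mem_zpowers_iff.mp (hg _)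
  choose k hk using hk
  have hcard : Fintype.card (ZMod q) < Fintype.card ι := by rwa [ZMod.card]
  obtain ⟨i, j, hij, hf⟩ := Fintype.exists_ne_map_eq_of_card_lt (fun i => ((k i : ℤ) : ZMod q)) hcard
  obtain ⟨c, hc⟩ := (ZMod.intCast_eq_intCast_iff_dvd_sub (k j) (k i) q).mp hf.symm
  refine ⟨i, j, hij, ((g ^ c : rootsOfUnity N M) : Mˣ), (g ^ c).2, ?_⟩
  have hi : ζ i = ((g ^ k i : rootsOfUnity N M) : Mˣ) := by rw [hk i]
  have hj : ζ j = ((g ^ k j : rootsOfUnity N M) : Mˣ) := by rw [hk j]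
  have hki : k i = k j + c * (q : ℤ) := by linarith
  have key : (g ^ k i : rootsOfUnity N M) = g ^ k j * (g ^ c) ^ q := by
    rw [hki, zpow_add, zpow_mul, zpow_natCast]
  rw [hi, hj, key, Subgroup.coe_mul, Subgroup.coe_pow]

section Field

variable (p : ℕ) [hp : Fact p.Prime]
variable {K : Type*} [NontriviallyNormedField K] [instK : NormedAlgebra ℚ_[p] K] [IsUltrametricDist K]
  [ProperSpace K]
variable {ϖ : Kˣ} (hϖ : IsUniformizer ϖ) {A : ℕ} (hA : absRamificationIdx p K = A * (p - 1))
include hϖ hA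

/-! ### §2. The transport: a full ball of radius `‖ϖ‖^{A−1}` in `Λ` forces `U^{(A·p−1)} ⊆ μ(K)·(𝒪^×)^p` -/

/-- **Transport.**  If `{‖z‖ ≤ ‖ϖ‖^{A−1}} ⊆ log_p(𝒪_K^×)` then every `v` with `‖1 − v‖ ≤ ‖ϖ‖^{A·p−1}` is
`ζ·u^p` with `ζ` a root of unity and `u` a unit: `x := p⁻¹·log_p v` has `‖x‖ = ‖ϖ‖^{−e}·‖1 − v‖ ≤ ‖ϖ‖^{A−1}`,
so `x = log_p u`, and `log_p(v·u^{−p}) = 0` means `v·u^{−p}` is torsion. [cite: NeukirchANT1999, Ch. II Prop. (5.5)–(5.7)] -/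
theorem exists_torsion_mul_pow_of_closedBall_pred_subset (hp2 : p ≠ 2)
    (h : closedBall (0 : K) (‖(ϖ : K)‖ ^ (A - 1)) ⊆ logUnits K) {v : K}
    (hv : ‖1 - v‖ ≤ ‖(ϖ : K)‖ ^ (A * p - 1)) :
    ∃ ζ u : K, (∃ n : ℕ, 0 < n ∧ ζ ^ n = 1) ∧ ‖u‖ = 1 ∧ v = ζ * u ^ p := by
  have hρ0 : 0 < ‖(ϖ : K)‖ := norm_units_pos ϖ
  have hA1 := one_le_level p hA
  have hAp := level_succ_le_pred p hA hp2
  have heA := absRamificationIdx_add_level p hA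
  have hθ := pow_level_succ_mul_rpow_lt_one p hϖ hA
  have hv' : ‖1 - v‖ ≤ ‖(ϖ : K)‖ ^ (A + 1) :=
    hv.trans (pow_le_pow_of_le_one hρ0.le hϖ.1.le hAp)
  have hvP : IsPrincipal v := hv'.trans_lt (pow_lt_one₀ hρ0.le hϖ.1 (by omega))
  have hvn : ‖v‖ = 1 := hvP.norm_eq_one
  have hv0 : v ≠ 0 := norm_pos_iff.mp (by rw [hvn]; exact one_pos)
  have hLv : ‖unitLog v‖ = ‖1 - v‖ := TorsionPowerCriterion.norm_unitLog_eq_norm_one_sub p hθ hv'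
  have hp0 : (p : K) ≠ 0 := by
    haveI := IwasawaLog.charZero p (F := K)
    exact_mod_cast hp.out.ne_zero
  have hpn : ‖(p : K)‖ = ‖(ϖ : K)‖ ^ absRamificationIdx p K := norm_prime_eq_norm_pow p K hϖ
  set x : K := (p : K)⁻¹ * unitLog v with hxdef
  -- `‖x‖ ≤ ‖ϖ‖^{A−1}`
  have hx : x ∈ closedBall (0 : K) (‖(ϖ : K)‖ ^ (A - 1)) := by
    rw [mem_closedBall_zero_iff, hxdef, norm_mul, norm_inv, hpn, hLv]
    have hsplit : ‖(ϖ : K)‖ ^ (A * p - 1) = ‖(ϖ : K)‖ ^ absRamificationIdx p K * ‖(ϖ : K)‖ ^ (A - 1) := by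
      rw [← pow_add]; congr 1; omega
    rw [inv_mul_le_iff₀ (pow_pos hρ0 _), ← hsplit]
    exact hv
  obtain ⟨u, hu, hux⟩ := (mem_logUnits_iff).mp (h hx)
  have hup : ‖u ^ p‖ = 1 := by rw [norm_pow, hu, one_pow]
  have hup0 : u ^ p ≠ 0 := norm_pos_iff.mp (by rw [hup]; exact one_pos)
  have hLup : unitLog (u ^ p) = unitLog v := by
    rw [unitLog_pow p hu, hux, hxdef, mul_inv_cancel_left₀ hp0]
  set ζ : K := v * (u ^ p)⁻¹ with hζdef
  have hζn : ‖ζ‖ = 1 := by rw [hζdef, norm_mul, norm_inv, hvn, hup, inv_one, mul_one]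
  have hLζ : unitLog ζ = 0 := by
    rw [hζdef, unitLog_mul p hvn (by rw [norm_inv, hup, inv_one]), unitLog_inv p hup, hLup, add_neg_cancel]
  obtain ⟨n, hn, hζpow⟩ := (unitLog_eq_zero_iff p K hζn).mp hLζ
  refine ⟨ζ, u, ⟨n, hn, hζpow⟩, hu, ?_⟩
  rw [hζdef, inv_mul_cancel_right₀ hup0]

/-! ### §4. The universal lower bound `r_in ≥ A` -/

/-- **The engine.**  If `{‖z‖ ≤ ‖ϖ‖^{A−1}} ⊆ log_p(𝒪_K^×)` and `c_0, …, c_p ∈ 𝒪` are `p + 1` coefficients such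
that, for `i ≠ j`, no `p`-th power of a unit has `‖1 − w^p‖ = ‖c_i − c_j‖·‖ϖ‖^{A·p−1}`, we reach a
contradiction: the principal units `v_i = 1 + c_i·ϖ^{A·p−1}` are `ζ_i·u_i^p` (§2), two of the `ζ_i` agree modulo
`p`-th powers of roots of unity (§3), and the quotient `v_i/v_j` is then the `p`-th power of a unit at the
forbidden level. [cite: NeukirchANT1999, Ch. II Prop. (5.5)–(5.7)] -/
theorem false_of_closedBall_pred_subset_of_family (hp2 : p ≠ 2)
    (h : closedBall (0 : K) (‖(ϖ : K)‖ ^ (A - 1)) ⊆ logUnits K) (c : Fin (p + 1) → K)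
    (hc : ∀ i, ‖c i‖ ≤ 1)
    (hsep : ∀ i j, i ≠ j → ∀ w : K, ‖w‖ = 1 →
      ‖1 - w ^ p‖ ≠ ‖c i - c j‖ * ‖(ϖ : K)‖ ^ (A * p - 1)) : False := by
  have hρ0 : 0 < ‖(ϖ : K)‖ := norm_units_pos ϖ
  set π : K := (ϖ : K) ^ (A * p - 1) with hπdef
  have hπn : ‖π‖ = ‖(ϖ : K)‖ ^ (A * p - 1) := by rw [hπdef, norm_pow]
  -- the family of principal units and its decomposition `v_i = ζ_i · u_i^p`
  set v : Fin (p + 1) → K := fun i => 1 + c i * π with hvdef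
  have hv : ∀ i, ‖1 - v i‖ ≤ ‖(ϖ : K)‖ ^ (A * p - 1) := fun i => by
    rw [hvdef]
    simp only
    rw [show (1 : K) - (1 + c i * π) = -(c i * π) by ring, norm_neg, norm_mul, hπn]
    exact mul_le_of_le_one_left (pow_nonneg hρ0.le _) (hc i)
  have hdec := fun i => exists_torsion_mul_pow_of_closedBall_pred_subset p hϖ hA hp2 h (hv i)
  choose ζ u hζ hu hvζ using hdec
  choose n hn hζn using hζ
  -- all `ζ_i` are `N`-th roots of unity, `N = ∏ n_i`
  set N : ℕ := ∏ i, n i with hNdef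
  have hN0 : N ≠ 0 := Finset.prod_ne_zero_iff.mpr fun i _ => (hn i).ne'
  haveI : NeZero N := ⟨hN0⟩
  have hζ0 : ∀ i, ζ i ≠ 0 := fun i h0 => by
    have := hζn i
    rw [h0, zero_pow (hn i).ne'] at this
    exact zero_ne_one this
  have hmem : ∀ i, Units.mk0 (ζ i) (hζ0 i) ∈ rootsOfUnity N K := fun i => by
    rw [mem_rootsOfUnity, Units.ext_iff, Units.val_pow_eq_pow_val, Units.val_mk0, Units.val_one]
    obtain ⟨d, hd⟩ := Finset.dvd_prod_of_mem n (Finset.mem_univ i)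
    rw [show N = n i * d from hd, pow_mul, hζn i, one_pow]
  have hcard : p < Fintype.card (Fin (p + 1)) := by rw [Fintype.card_fin]; omega
  obtain ⟨i, j, hij, η, -, hη⟩ :=
    exists_ne_eq_mul_pow_of_rootsOfUnity p N hp.out.ne_zero hcard (fun i => Units.mk0 (ζ i) (hζ0 i)) hmem
  have hη' : ζ i = ζ j * (η : K) ^ p := by
    have := congrArg (fun z : Kˣ => (z : K)) hη
    simpa using this
  have hηn : ‖(η : K)‖ = 1 := by
    have h1 : ‖ζ i‖ = ‖ζ j‖ * ‖(η : K)‖ ^ p := by rw [hη', norm_mul, norm_pow]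
    have hζin : ‖ζ i‖ = 1 := norm_eq_one_of_pow_eq_one_of_pos (hn i) (hζn i)
    have hζjn : ‖ζ j‖ = 1 := norm_eq_one_of_pow_eq_one_of_pos (hn j) (hζn j)
    rw [hζin, hζjn, one_mul] at h1
    exact (pow_eq_one_iff_of_nonneg (norm_nonneg _) hp.out.ne_zero).mp h1.symm
  -- the unit `W = η·u_i·u_j⁻¹` has `W^p = v_i / v_j`
  have huj0 : u j ≠ 0 := norm_pos_iff.mp (by rw [hu j]; exact one_pos)
  have hvjn : ‖v j‖ = 1 := by
    rw [hvζ j, norm_mul, norm_pow, hu j, one_pow, mul_one]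
    exact norm_eq_one_of_pow_eq_one_of_pos (hn j) (hζn j)
  have hvj0 : v j ≠ 0 := norm_pos_iff.mp (by rw [hvjn]; exact one_pos)
  set W : K := (η : K) * u i * (u j)⁻¹ with hWdef
  have hWn : ‖W‖ = 1 := by rw [hWdef, norm_mul, norm_mul, norm_inv, hηn, hu i, hu j, inv_one, mul_one, mul_one]
  have hζj0 : ζ j ≠ 0 := hζ0 j
  have hWp : W ^ p = v i * (v j)⁻¹ := by
    have h1 : v i * (v j)⁻¹ = (η : K) ^ p * u i ^ p * (u j ^ p)⁻¹ := by
      rw [hvζ i, hvζ j, hη', mul_inv]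
      calc ζ j * (η : K) ^ p * u i ^ p * ((ζ j)⁻¹ * (u j ^ p)⁻¹)
          = (ζ j * (ζ j)⁻¹) * ((η : K) ^ p * u i ^ p * (u j ^ p)⁻¹) := by ring
        _ = (η : K) ^ p * u i ^ p * (u j ^ p)⁻¹ := by rw [mul_inv_cancel₀ hζj0, one_mul]
    rw [h1, hWdef, mul_pow, mul_pow, inv_pow]
  have h2 : (1 : K) - v i * (v j)⁻¹ = (v j - v i) * (v j)⁻¹ := by rw [sub_mul, mul_inv_cancel₀ hvj0]
  have hlev : ‖1 - W ^ p‖ = ‖c i - c j‖ * ‖(ϖ : K)‖ ^ (A * p - 1) := by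
    rw [hWp, h2, norm_mul, norm_inv, hvjn, inv_one, mul_one, hvdef]
    show ‖(1 + c j * π) - (1 + c i * π)‖ = _
    rw [show (1 : K) + c j * π - (1 + c i * π) = -((c i - c j) * π) by ring, norm_neg, norm_mul, hπn]
  exact hsep i j hij W hWn hlev

omit hϖ hA [IsUltrametricDist K] [ProperSpace K] in
/-- Distinct rational integers `i, j < p` are incongruent modulo `𝔪`: `‖i − j‖ = 1`.
[cite: NeukirchANT1999, Ch. II (5.5)] -/
theorem norm_natCast_sub_natCast_eq_one {i j : ℕ} (hi : i < p) (hj : j < p) (hij : i ≠ j) :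
    ‖(i : K) - (j : K)‖ = 1 := by
  wlog hlt : j < i generalizing i j
  · rw [← norm_neg, neg_sub]
    exact this hj hi (Ne.symm hij) (lt_of_le_of_ne (not_lt.mp hlt) hij)
  rw [← Nat.cast_sub hlt.le]
  refine norm_natCast_eq_one_of_not_dvd p ?_
  intro hdvd
  have := Nat.le_of_dvd (by omega) hdvd
  omega

/-- **`{‖z‖ ≤ ‖ϖ‖^{A−1}} ⊄ log_p(𝒪_K^×)` at EVERY tie index `e = A·(p−1)`, for EVERY `K`** (`p` odd; `ζ_p ∈ K`
and `p ∣ A` allowed): the inner radius of the log-unit lattice is `≥ e/(p−1)`.  Case `ζ_p ∉ K`: part V.  Case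
`ζ_p ∈ K`, `f ≥ 2`: the engine with `p + 1` pairwise incongruent coefficients (levels `A·p − 1` are forbidden for
`p`-th powers).  Case `ζ_p ∈ K`, `f = 1`: the engine with `c ∈ {0, 1, …, p−1, ϖ}` (levels `A·p − 1` and `A·p` are
both forbidden). [cite: NeukirchANT1999, Ch. II Prop. (5.5)–(5.7)] [cite: Washington1997, Lemma 1.4, §5.1] -/
theorem not_closedBall_pred_subset_logUnits_of_level (hp2 : p ≠ 2) :
    ¬ closedBall (0 : K) (‖(ϖ : K)‖ ^ (A - 1)) ⊆ logUnits K := by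
  intro h
  have hρ0 : 0 < ‖(ϖ : K)‖ := norm_units_pos ϖ
  have hA1 := one_le_level p hA
  by_cases hμ : ∀ ζ : K, ζ ^ p = 1 → ζ = 1
  · exact not_closedBall_pred_subset_logUnits' p hϖ hA hp2 hμ h
  push Not at hμ
  obtain ⟨ζ, hζ, hζ1⟩ := hμ
  have hnat : ∀ i : Fin (p + 1), (i : ℕ) < p ∨ (i : ℕ) = p := fun i => by omega
  by_cases hf : ∃ t : K, ‖t‖ ≤ 1 ∧ ∀ i : ℕ, i < p → ‖t - i‖ = 1
  · -- `f ≥ 2`: `p + 1` pairwise incongruent coefficients `0, 1, …, p − 1, t`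
    obtain ⟨t, ht1, ht⟩ := hf
    let c : Fin (p + 1) → K := fun i => if (i : ℕ) < p then ((i : ℕ) : K) else t
    refine false_of_closedBall_pred_subset_of_family p hϖ hA hp2 h c (fun i => ?_) (fun i j hij w _ => ?_)
    · simp only [c]
      split_ifs
      · exact IwasawaLog.norm_natCast_le_one p (F := K) _
      · exact ht1
    · have hcij : ‖c i - c j‖ = 1 := by
        simp only [c]
        rcases hnat i with hi | hi <;> rcases hnat j with hj | hj
        · rw [if_pos hi, if_pos hj]
          exact norm_natCast_sub_natCast_eq_one p hi hj (fun h' => hij (Fin.ext h'))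
        · rw [if_pos hi, if_neg (by omega), ← norm_neg, neg_sub]; exact ht _ hi
        · rw [if_neg (by omega), if_pos hj]; exact ht _ hj
        · exact absurd (Fin.ext (hi.trans hj.symm)) hij
      rw [hcij, one_mul]
      exact norm_one_sub_pow_prime_ne_pred p hϖ hA hp2 w
  · -- `f = 1`: coefficients `0, 1, …, p − 1, ϖ`
    push Not at hf
    have hf' : ∀ t : K, ‖t‖ ≤ 1 → ∃ i : ℕ, i < p ∧ ‖t - i‖ < 1 := fun t ht => by
      obtain ⟨i, hi, hne⟩ := hf t ht
      refine ⟨i, hi, lt_of_le_of_ne ?_ hne⟩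
      rw [sub_eq_add_neg]
      exact (IsUltrametricDist.norm_add_le_max _ _).trans
        (max_le ht (by rw [norm_neg]; exact IwasawaLog.norm_natCast_le_one p (F := K) i))
    let c : Fin (p + 1) → K := fun i => if (i : ℕ) < p then ((i : ℕ) : K) else (ϖ : K)
    refine false_of_closedBall_pred_subset_of_family p hϖ hA hp2 h c (fun i => ?_) (fun i j hij w _ => ?_)
    · simp only [c]
      split_ifs
      · exact IwasawaLog.norm_natCast_le_one p (F := K) _
      · exact hϖ.1.le
    · -- `‖c i − c j‖ = 1`, or `= ‖ϖ‖` (the pair `{0, ϖ}`)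
      have key : ∀ a : ℕ, a < p → ‖(a : K) - (ϖ : K)‖ = 1 ∨ ‖(a : K) - (ϖ : K)‖ = ‖(ϖ : K)‖ := by
        intro a ha
        rcases Nat.eq_zero_or_pos a with ha0 | ha0
        · right; rw [ha0, Nat.cast_zero, zero_sub, norm_neg]
        · left
          have han : ‖(a : K)‖ = 1 := norm_natCast_eq_one_of_not_dvd p (fun hd => by
            have := Nat.le_of_dvd ha0 hd; omega)
          rw [sub_eq_add_neg, IsUltrametricDist.norm_add_eq_max_of_norm_ne_norm
            (by rw [han, norm_neg]; exact hϖ.1.ne'), han, norm_neg, max_eq_left hϖ.1.le]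
      have hcases : ‖c i - c j‖ = 1 ∨ ‖c i - c j‖ = ‖(ϖ : K)‖ := by
        simp only [c]
        rcases hnat i with hi | hi <;> rcases hnat j with hj | hj
        · rw [if_pos hi, if_pos hj]
          exact Or.inl (norm_natCast_sub_natCast_eq_one p hi hj (fun h' => hij (Fin.ext h')))
        · rw [if_pos hi, if_neg (by omega)]; exact key _ hi
        · rw [if_neg (by omega), if_pos hj, ← norm_neg, neg_sub]; exact key _ hj
        · exact absurd (Fin.ext (hi.trans hj.symm)) hij
      rcases hcases with h1 | h1
      · rw [h1, one_mul]
        exact norm_one_sub_pow_prime_ne_pred p hϖ hA hp2 w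
      · rw [h1, ← pow_succ', show A * p - 1 + 1 = A * p by
          have := level_succ_le_pred p hA hp2; omega]
        exact norm_one_sub_pow_prime_ne_level p hϖ hA hf' hζ hζ1 w

/-- **The universal tie bracket `A ≤ r_in ≤ A + 1`** in the R-W format: at `e = A·(p−1)` (`p` odd, any `A`, any
`K`), `{‖z‖ ≤ ‖ϖ‖^{A+1}} ⊆ log_p(𝒪_K^×)` and `{‖z‖ ≤ ‖ϖ‖^{A−1}} ⊄ log_p(𝒪_K^×)`.
[cite: NeukirchANT1999, Ch. II Prop. (5.5)–(5.7)] -/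
theorem innerRadius_tie_bracket (hp2 : p ≠ 2) :
    closedBall (0 : K) (‖(ϖ : K)‖ ^ (A + 1)) ⊆ logUnits K ∧
      ¬ closedBall (0 : K) (‖(ϖ : K)‖ ^ (A - 1)) ⊆ logUnits K := by
  refine ⟨?_, not_closedBall_pred_subset_logUnits_of_level p hϖ hA hp2⟩
  have h := closedBall_div_succ_subset_logUnits p hϖ (K := K)
  rwa [div_eq_level p hA] at h

/-- **`r_in = A` EXACTLY given a TORSION WITNESS** (abc-iut-s2-p12's criterion, `UnitLogInnerRadiusTieTorsionFill`,
upper half BY NAME + this file's universal lower half): if some root of unity `ζ'` of `K` that is not a `p`-th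
power in `K` has `‖u^p − ζ'‖ ≤ ‖p‖·‖ϖ‖^A`, then `{‖z‖ ≤ ‖ϖ‖^A} ⊆ log_p(𝒪_K^×)` and `{‖z‖ ≤ ‖ϖ‖^{A−1}} ⊄ log_p(𝒪_K^×)`.
With abc-iut-s2-p12's `innerRadius_tie_succ_of_forall_not_torsionWitness` (`r_in = A + 1` without a witness)
the tie case is thereby decided EXACTLY from one bit, and bracketed WITHOUT it (`innerRadius_tie_bracket`).
[cite: SerreLocalFields1979, Ch. XIV §4] [cite: NeukirchANT1999, Ch. II Prop. (5.5)–(5.7)] -/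
theorem innerRadius_tie_of_exists_torsionWitness (hp2 : p ≠ 2)
    (hex : ∃ ζ' u : K, (∃ n : ℕ, 0 < n ∧ ζ' ^ n = 1) ∧ (∀ η : K, η ^ p ≠ ζ') ∧
      ‖u ^ p - ζ'‖ ≤ ‖(p : K)‖ * ‖(ϖ : K)‖ ^ A) :
    closedBall (0 : K) (‖(ϖ : K)‖ ^ A) ⊆ logUnits K ∧
      ¬ closedBall (0 : K) (‖(ϖ : K)‖ ^ (A - 1)) ⊆ logUnits K :=
  ⟨closedBall_level_subset_logUnits_of_exists_torsionWitness p hϖ hA hp2 hex,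
    not_closedBall_pred_subset_logUnits_of_level p hϖ hA hp2⟩

end Field

section Uniform

variable (p : ℕ) [hp : Fact p.Prime]
variable {K : Type*} [NontriviallyNormedField K] [instK : NormedAlgebra ℚ_[p] K] [IsUltrametricDist K]
  [ProperSpace K]
variable {ϖ : Kˣ} (hϖ : IsUniformizer ϖ)
include hϖ

/-- **`(p−1) ∣ e` ⇒ `{‖z‖ ≤ ‖ϖ‖^{e/(p−1) − 1}} ⊄ log_p(𝒪_K^×)`** (`p` odd, every `K`): the lower bound
`r_in ≥ e/(p−1)` keyed by the divisibility. [cite: NeukirchANT1999, Ch. II Prop. (5.5)–(5.7)] -/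
theorem not_closedBall_div_pred_subset_logUnits_of_dvd (hp2 : p ≠ 2)
    (hdvd : p - 1 ∣ absRamificationIdx p K) :
    ¬ closedBall (0 : K) (‖(ϖ : K)‖ ^ (absRamificationIdx p K / (p - 1) - 1)) ⊆ logUnits K :=
  not_closedBall_pred_subset_logUnits_of_level p hϖ (A := absRamificationIdx p K / (p - 1))
    (Nat.div_mul_cancel hdvd).symm hp2

/-- **`r_in ≥ ⌊e/(p−1)⌋` for EVERY odd `p` and EVERY `K`**: `{‖z‖ ≤ ‖ϖ‖^{⌊e/(p−1)⌋ − 1}} ⊄ log_p(𝒪_K^×)`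
— off ties by abc-iut-c312-3's `not_closedBall_div_subset_logUnits` (even the next ball fails), at ties by
`not_closedBall_div_pred_subset_logUnits_of_dvd`.  Together with `closedBall_div_succ_subset_logUnits`
(`{‖z‖ ≤ ‖ϖ‖^{⌊e/(p−1)⌋ + 1}} ⊆ log_p(𝒪_K^×)`, every `p`, `e`) this brackets the inner radius within one unit of
`e/(p−1)` with NO hypothesis on `K`. [cite: NeukirchANT1999, Ch. II Prop. (5.5)–(5.7)] -/
theorem not_closedBall_div_pred_subset_logUnits (hp2 : p ≠ 2) :
    ¬ closedBall (0 : K) (‖(ϖ : K)‖ ^ (absRamificationIdx p K / (p - 1) - 1)) ⊆ logUnits K := by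
  by_cases hdvd : p - 1 ∣ absRamificationIdx p K
  · exact not_closedBall_div_pred_subset_logUnits_of_dvd p hϖ hp2 hdvd
  · intro h
    refine not_closedBall_div_subset_logUnits p hϖ hdvd (Subset.trans ?_ h)
    exact closedBall_subset_closedBall
      (pow_le_pow_of_le_one (norm_nonneg _) hϖ.1.le (Nat.sub_le _ _))

end Uniform

end LogEnvelope

end Literature.IUT.LogVolume

end
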